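import Mathlib
import Literature.Probability.Percolation.SharpnessDCTProofs
import Literature.Probability.Percolation.RSW
import Literature.Probability.Percolation.ConnectivityProofs

/-!
# Crux `PercNonProliferation.FreeBoxPowerSaving` (stmt-CriticalPhenomena-4447), line
# `boundary-interior-split-fat-finite-clusters` — stub `stub_boundaryInteriorSplit`

Helper file for the checked skeleton of the crux `FreeBoxPowerSaving` (route
`PercNonProliferation`), line `boundary-interior-split-fat-finite-clusters`
(`Cruxes/FreeBoxPowerSaving/Lines/boundary_interior_split_fat_finite_clusters.lean`).  Proves
exactly the registered stub signature `stub_boundaryInteriorSplit` (the boundary/interior split of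
the in-box pieces of the free box, in one-bit form); lands with
`--supports stmt-CriticalPhenomena-4447`.

## The statement

Bond percolation `P_p` on `ℤ³`, free box `B = B(n) = box 3 n`, doubled box `B₂ = box 3 (2n)`.
For `u ∈ B` the PIECE of `u` is `piece(u) = {v ∈ B : u ↔ v by an open path inside B}`.  With
`QG = {∃ u ∈ B, #piece(u) ≥ s}` and `BQG = {∃ u ∈ ∂ⁱⁿB, #piece(u) ≥ s}` (`∂ⁱⁿB` the inner vertex
boundary), for every `p`, `n` and real `s > 0`:

`P_p(QG) ≤ P_p(BQG) + |B| · (Σ_{y ∈ B₂} P_p(0 ↔ y, C(0) ⊆ B₂)) / s²`.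

## The argument (elementary, every `p`)

1. `P(QG) ≤ P(BQG) + P(QG ∖ BQG)` (subadditivity).
2. On the full-measure event `ω ⊆ E(ℤ³)` (`ae_subset_edgeSet`), let `ω ∈ QG ∖ BQG` and pick
   `u ∈ B` with `#piece(u) ≥ s`.  Pieces are the classes of an equivalence relation on `B`
   (`piece_eq_of_mem`), so no vertex of `piece(u)` lies on `∂ⁱⁿB` (else `BQG`).  Hence
   `piece(u)` is a whole cluster (`mem_piece_of_reachable`): along an open path from `u`, an open
   edge `xy` with `x ∈ piece(u)` is a lattice edge, and `y ∉ B` would put `x ∈ ∂ⁱⁿB`; so `y ∈ B`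
   and the in-box path extends.  Consequently, for each of the `≥ s` vertices `v ∈ piece(u)`,
   `C(v) = piece(u) ⊆ B ⊆ v + B₂`, i.e. the RECENTRED configuration `ω - v` lies in
   `A₀ = {s ≤ Σ_{y ∈ B₂} 1{0 ↔ y, C(0) ⊆ B₂}}` (`centred_piece`, `le_sum_indicator`):
   pointwise `s · 1_{QG ∖ BQG} ≤ Σ_{v ∈ B} 1_{A_v}` with `A_v = (ω ↦ ω - v)⁻¹(A₀)`.
3. First moment (`mul_measureReal_le_sum`, Markov for a sum of indicators):
   `s · P(QG ∖ BQG) ≤ Σ_{v ∈ B} P(A_v) = |B| · P(A₀)` by translation invariance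
   (`bondPercolation_real_preimage_shift`).
4. First moment again: `s · P(A₀) ≤ Σ_{y ∈ B₂} P(0 ↔ y, C(0) ⊆ B₂)`.
5. Combine (`split_of_parts`): `P(QG ∖ BQG) ≤ |B| · (Σ_y …) / s²`.

Degenerate parameters need no special treatment (`n = 0`: `∂ⁱⁿB(0) = B(0) = {0}`; `p ∈ {0, 1}`;
`s > |B|`: both events empty).

Measurability: `{0 ↔ y}` is measurable (`measurableSet_openConn_holds`), `{C(0) ⊆ B₂}` is the
countable intersection `⋂_{y ∉ B₂} {0 ↔ y}ᶜ` (`measurableSet_cluster_subset`), `A₀` is a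
super-level set of a finite sum of indicators, and `A_v` is its preimage under the measurable
relabelling `BondConfig.relabel`.

Mathlib API: `mul_meas_ge_le_integral_of_nonneg`, `integral_finsetSum`, `integral_indicator_one`,
`measure_mono_ae`, `measureReal_union_le`, `Finset.natCast_card_filter`,
`Finset.card_image_of_injective`, `SimpleGraph.reachable_iff_reflTransGen`.
Tree API: `ae_subset_edgeSet` (`RSW.lean`), `bondPercolation_real_preimage_shift`,
`BondConfig.relabel` (`BondPercolationSymmetry.lean`), `openCluster_relabel_shift`
(`ConnectivityProofs.lean`), `DCT16.pathIn_of_mem_openConnIn`, `DCT16.mem_openConnIn_of_pathIn`,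
`DCT16.reachable_of_pathIn` (`SharpnessDCTProofs.lean`), `measurableSet_openConn_holds`
(`PercolationProofs.lean`), `mem_innerBoundary_iff`, `mem_box`.

No new definitions: the events are written out as set-builder expressions exactly as registered.
-/

noncomputable section

open MeasureTheory Filter
open Literature.Probability.Percolation Literature.Probability.LatticeModels
open scoped Topology Classical BigOperators

namespace Summit.CriticalPhenomena.PercolationContinuityZ3.FreeBoxPowerSavingLine

namespace BoundaryInteriorSplit

/-! ### §1 Measure-theoretic tools: Markov for a sum of indicators, and the final bookkeeping -/

/-- **First moment (Markov) for a counting variable.**  For a finite measure `μ`, a finite index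
set `B`, measurable events `A v` (`v ∈ B`), a set `S` and `s ≥ 0`: if almost surely on `S` at
least "`s` of the events `A v` occur" (`s ≤ Σ_{v ∈ B} 1_{A v}`), then
`s · μ(S) ≤ Σ_{v ∈ B} μ(A v)`. [folklore] -/
theorem mul_measureReal_le_sum {Ω ι : Type*} [MeasurableSpace Ω] (μ : Measure Ω)
    [IsFiniteMeasure μ] (B : Finset ι) (A : ι → Set Ω) (hA : ∀ v ∈ B, MeasurableSet (A v))
    (S : Set Ω) {s : ℝ} (hs : 0 ≤ s)
    (h : ∀ᵐ ω ∂μ, ω ∈ S → s ≤ ∑ v ∈ B, (A v).indicator (1 : Ω → ℝ) ω) :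
    s * μ.real S ≤ ∑ v ∈ B, μ.real (A v) := by
  set f : Ω → ℝ := fun ω => ∑ v ∈ B, (A v).indicator (1 : Ω → ℝ) ω with hf
  have hint : ∀ v ∈ B, Integrable ((A v).indicator (1 : Ω → ℝ)) μ :=
    fun v hv => (integrable_const (1 : ℝ)).indicator (hA v hv)
  have hf_int : Integrable f μ := integrable_finsetSum _ hint
  have hf_nn : 0 ≤ᵐ[μ] f := ae_of_all _ fun ω =>
    Finset.sum_nonneg fun v _ => Set.indicator_nonneg (fun _ _ => zero_le_one) _
  have hmarkov := mul_meas_ge_le_integral_of_nonneg hf_nn hf_int s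
  have hf_eq : ∫ ω, f ω ∂μ = ∑ v ∈ B, μ.real (A v) := by
    rw [integral_finsetSum _ hint]
    exact Finset.sum_congr rfl fun v hv => integral_indicator_one (hA v hv)
  have hle : S ≤ᵐ[μ] {ω | s ≤ f ω} := h.mono fun ω hω => hω
  have hmono : μ.real S ≤ μ.real {ω | s ≤ f ω} :=
    ENNReal.toReal_mono (measure_ne_top _ _) (measure_mono_ae hle)
  calc s * μ.real S ≤ s * μ.real {ω | s ≤ f ω} := mul_le_mul_of_nonneg_left hmono hs
    _ ≤ ∫ ω, f ω ∂μ := hmarkov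
    _ = ∑ v ∈ B, μ.real (A v) := hf_eq

/-- **Bookkeeping.**  From `s · μ(QG ∖ BQG) ≤ N · μ(A₀)` and `s · μ(A₀) ≤ CV` (`s > 0`, `N ≥ 0`):
`μ(QG) ≤ μ(BQG) + N · CV / s²` (subadditivity `μ(QG) ≤ μ(BQG) + μ(QG ∖ BQG)` and division by
`s²`). [folklore] -/
theorem split_of_parts {Ω : Type*} [MeasurableSpace Ω] (μ : Measure Ω) [IsFiniteMeasure μ]
    (QG BQG A0 : Set Ω) {N CV s : ℝ} (hs : 0 < s) (hN : 0 ≤ N)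
    (h2 : s * μ.real (QG \ BQG) ≤ N * μ.real A0) (h4 : s * μ.real A0 ≤ CV) :
    μ.real QG ≤ μ.real BQG + N * CV / s ^ 2 := by
  have h1 : μ.real QG ≤ μ.real BQG + μ.real (QG \ BQG) :=
    calc μ.real QG ≤ μ.real (BQG ∪ QG \ BQG) :=
          measureReal_mono (by rw [Set.union_sdiff_self]; exact Set.subset_union_right)
            (measure_ne_top _ _)
      _ ≤ μ.real BQG + μ.real (QG \ BQG) := measureReal_union_le _ _
  have hkey : μ.real (QG \ BQG) ≤ N * CV / s ^ 2 := by
    rw [le_div_iff₀ (pow_pos hs 2)]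
    calc μ.real (QG \ BQG) * s ^ 2 = (s * μ.real (QG \ BQG)) * s := by ring
      _ ≤ (N * μ.real A0) * s := mul_le_mul_of_nonneg_right h2 hs.le
      _ = N * (s * μ.real A0) := by ring
      _ ≤ N * CV := mul_le_mul_of_nonneg_left h4 hN
  linarith

/-- **The confinement event is measurable**: `{C(x) ⊆ S} = ⋂_{y ∉ S} {x ↔ y}ᶜ`, a countable
intersection of complements of connection events. [folklore] -/
theorem measurableSet_cluster_subset {V : Type*} [Countable V] (x : V) (S : Set V) :
    MeasurableSet {ω : BondConfig V | openCluster ω x ⊆ S} := by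
  have h : {ω : BondConfig V | openCluster ω x ⊆ S} = ⋂ y ∈ Sᶜ, (openConn x y)ᶜ := by
    ext ω
    simp only [openCluster, openConn, Set.subset_def, Set.mem_setOf_eq, Set.mem_iInter,
      Set.mem_compl_iff]
    exact ⟨fun h y hy hr => hy (h y hr), fun h y hr => by_contra fun hy => h y hy hr⟩
  rw [h]
  exact MeasurableSet.biInter (Set.to_countable _) fun y _ => (measurableSet_openConn_holds x y).compl

/-- On the confinement event `{C(x) ⊆ S}` the number of target events `{x ↔ y} ∩ {C(x) ⊆ S}`,
`y ∈ B`, that occur is the number of `y ∈ B` joined to `x`. [folklore] -/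
theorem sum_indicator_eq_card {V : Type*} (B : Finset V) (S : Set V) (x : V) {ω : BondConfig V}
    (hC : openCluster ω x ⊆ S) :
    ∑ y ∈ B, (openConn x y ∩ {ω' : BondConfig V | openCluster ω' x ⊆ S}).indicator
        (1 : BondConfig V → ℝ) ω = ((B.filter fun y => ω ∈ openConn x y).card : ℝ) := by
  rw [Finset.natCast_card_filter]
  refine Finset.sum_congr rfl fun y _ => ?_
  by_cases hy : ω ∈ openConn x y
  · rw [if_pos hy, Set.indicator_of_mem (Set.mem_inter hy hC), Pi.one_apply]
  · rw [if_neg hy, Set.indicator_of_notMem fun h => hy h.1]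

/-! ### §2 Pieces of a finite vertex set: equivalence classes; interior pieces are clusters -/

/-- **Pieces are equivalence classes.**  If `w` lies in the piece of `u` (i.e. `u ↔ w` inside `S`),
then the piece of `w` is the piece of `u` (symmetry and transitivity of `· ↔ · in S`). [folklore] -/
theorem piece_eq_of_mem {V : Type*} (S : Finset V) {ω : BondConfig V} {u w : V}
    (h : ω ∈ openConnIn (↑S : Set V) u w) :
    (S.filter fun v => ω ∈ openConnIn (↑S : Set V) w v) =
      S.filter fun v => ω ∈ openConnIn (↑S : Set V) u v := by
  refine Finset.filter_congr fun v _ => ⟨fun h' => ?_, fun h' => ?_⟩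
  · obtain ⟨hu, _, hr⟩ := h
    obtain ⟨_, hv, hr'⟩ := h'
    exact ⟨hu, hv, hr.trans hr'⟩
  · obtain ⟨_, hw, hr⟩ := h
    obtain ⟨_, hv, hr'⟩ := h'
    exact ⟨hw, hv, hr.symm.trans hr'⟩

/-- Two vertices of one piece are joined by an open path (a path inside `S` is a path). [folklore] -/
theorem reachable_of_mem_piece {V : Type*} (S : Finset V) {ω : BondConfig V} {u v w : V}
    (hv : v ∈ S.filter fun x => ω ∈ openConnIn (↑S : Set V) u x)
    (hw : w ∈ S.filter fun x => ω ∈ openConnIn (↑S : Set V) u x) :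
    (openGraph ω).Reachable v w := by
  obtain ⟨_, hv', hr⟩ := (Finset.mem_filter.1 hv).2
  obtain ⟨_, hw', hr'⟩ := (Finset.mem_filter.1 hw).2
  exact DCT16.reachable_of_pathIn (DCT16.pathIn_of_mem_openConnIn ⟨hv', hw', hr.symm.trans hr'⟩)

/-- **An interior piece is a whole cluster.**  On `ℤ^d`, if `ω ⊆ E(ℤ^d)`, `u ∈ S`, and no vertex of
the piece of `u` lies on the inner vertex boundary `∂ⁱⁿS`, then every vertex joined to `u` by an open
path lies in the piece of `u`: along the path, an open edge `bc` with `b` in the piece is a lattice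
edge, so `c ∉ S` would put `b ∈ ∂ⁱⁿS`; hence `c ∈ S` and the in-`S` path extends. [folklore] -/
theorem mem_piece_of_reachable {d : ℕ} (S : Finset (Site d)) {ω : BondConfig (Site d)}
    (hω : ω ⊆ (zdGraph d).edgeSet) {u : Site d} (hu : u ∈ S)
    (hint : ∀ w ∈ S.filter (fun v => ω ∈ openConnIn (↑S : Set (Site d)) u v),
      w ∉ innerBoundary (zdGraph d) S)
    {z : Site d} (hz : (openGraph ω).Reachable u z) :
    z ∈ S.filter fun v => ω ∈ openConnIn (↑S : Set (Site d)) u v := by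
  rw [SimpleGraph.reachable_iff_reflTransGen] at hz
  induction hz with
  | refl =>
    exact Finset.mem_filter.2
      ⟨hu, Finset.mem_coe.2 hu, Finset.mem_coe.2 hu, SimpleGraph.Reachable.refl _⟩
  | @tail b c _ hbc ih =>
    obtain ⟨hbS, hub⟩ := Finset.mem_filter.1 ih
    have hadj : (zdGraph d).Adj b c :=
      (SimpleGraph.mem_edgeSet _).1 (hω ((openGraph_adj ω b c).1 hbc).1)
    have hcS : c ∈ S := by
      by_contra hc
      exact hint b ih (mem_innerBoundary_iff.2 ⟨hbS, c, hc, hadj⟩)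
    exact Finset.mem_filter.2 ⟨hcS, DCT16.mem_openConnIn_of_pathIn
      ((DCT16.pathIn_of_mem_openConnIn hub).tail hbc (Finset.mem_coe.2 hcS))⟩

/-- **Recentring an interior piece.**  Under the hypotheses of `mem_piece_of_reachable` with
`S = B(n)`, for every vertex `v` of the piece of `u` the recentred configuration `ω - v` satisfies:
at least `#piece(u)` vertices of `B(2n)` are joined to `0`, and `C(0) ⊆ B(2n)` (because
`C_ω(v) = piece(u) ⊆ B(n) ⊆ v + B(2n)` and `C_{ω - v}(0) = C_ω(v) - v`,
`openCluster_relabel_shift`). [folklore] -/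
theorem centred_piece {d : ℕ} (n : ℕ) {ω : BondConfig (Site d)} (hω : ω ⊆ (zdGraph d).edgeSet)
    {u : Site d} (hu : u ∈ box d n)
    (hint : ∀ w ∈ (box d n).filter (fun v => ω ∈ openConnIn (↑(box d n) : Set (Site d)) u v),
      w ∉ innerBoundary (zdGraph d) (box d n))
    {v : Site d}
    (hv : v ∈ (box d n).filter fun x => ω ∈ openConnIn (↑(box d n) : Set (Site d)) u x) :
    ((box d n).filter fun x => ω ∈ openConnIn (↑(box d n) : Set (Site d)) u x).card ≤
        ((box d (2 * n)).filter fun y =>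
          BondConfig.relabel (sym2Equiv (Site.shift (-v))) ω ∈ openConn (0 : Site d) y).card ∧
      openCluster (BondConfig.relabel (sym2Equiv (Site.shift (-v))) ω) 0 ⊆ ↑(box d (2 * n)) := by
  set P := (box d n).filter fun x => ω ∈ openConnIn (↑(box d n) : Set (Site d)) u x with hP
  set ω' := BondConfig.relabel (sym2Equiv (Site.shift (-v))) ω with hω'
  -- the recentred cluster of `0` is the cluster of `v`, translated by `-v`
  have hclus : openCluster ω' 0 = (fun z => z + -v) '' openCluster ω v := by
    have h := openCluster_relabel_shift (-v) ω v
    rwa [add_neg_cancel] at h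
  -- `u` lies in its own piece
  have huP : u ∈ P :=
    Finset.mem_filter.2 ⟨hu, Finset.mem_coe.2 hu, Finset.mem_coe.2 hu, SimpleGraph.Reachable.refl _⟩
  -- the cluster of `v` is the piece of `u`, inside the box
  have hCv : openCluster ω v ⊆ ↑(box d n) := by
    intro z hz
    have huz : (openGraph ω).Reachable u z := (reachable_of_mem_piece _ huP hv).trans hz
    exact Finset.mem_coe.2 (Finset.mem_filter.1 (mem_piece_of_reachable _ hω hu hint huz)).1
  have hvB : v ∈ box d n := (Finset.mem_filter.1 hv).1
  -- recentring at `v ∈ B(n)` maps `B(n)` into `B(2n)`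
  have hshift : ∀ z ∈ box d n, z + -v ∈ box d (2 * n) := by
    intro z hz
    have hvB' := hvB
    rw [mem_box] at hz hvB' ⊢
    intro i
    have h1 := hz i
    have h2 := hvB' i
    simp only [Pi.add_apply, Pi.neg_apply]
    push_cast
    omega
  refine ⟨?_, ?_⟩
  · calc P.card = (P.image fun z => z + -v).card :=
          (Finset.card_image_of_injective _ (add_left_injective (-v))).symm
      _ ≤ _ := Finset.card_le_card ?_
    intro y hy
    obtain ⟨w, hw, rfl⟩ := Finset.mem_image.1 hy
    refine Finset.mem_filter.2 ⟨hshift w (Finset.mem_filter.1 hw).1, ?_⟩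
    show w + -v ∈ openCluster ω' 0
    rw [hclus]
    exact ⟨w, reachable_of_mem_piece _ hv hw, rfl⟩
  · rw [hclus]
    rintro _ ⟨z, hz, rfl⟩
    exact Finset.mem_coe.2 (hshift z (hCv hz))

/-- **The pointwise split.**  If `ω ⊆ E(ℤ^d)`, some piece of `B(n)` has `≥ s` vertices, and no piece
touching `∂ⁱⁿB(n)` has `≥ s` vertices, then at least `s` of the recentred events
`A_v = (ω ↦ ω - v)⁻¹ {s ≤ Σ_{y ∈ B(2n)} 1{0 ↔ y, C(0) ⊆ B(2n)}}`, `v ∈ B(n)`, occur — namely for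
every `v` of a large piece, which is interior and hence a whole cluster. [folklore] -/
theorem le_sum_indicator {d : ℕ} (n : ℕ) (s : ℝ) {ω : BondConfig (Site d)}
    (hω : ω ⊆ (zdGraph d).edgeSet)
    (hQG : ∃ u ∈ box d n,
      s ≤ (((box d n).filter fun v => ω ∈ openConnIn ↑(box d n) u v).card : ℝ))
    (hBQG : ¬ ∃ u ∈ innerBoundary (zdGraph d) (box d n),
      s ≤ (((box d n).filter fun v => ω ∈ openConnIn ↑(box d n) u v).card : ℝ)) :
    s ≤ ∑ v ∈ box d n, (BondConfig.relabel (sym2Equiv (Site.shift (-v))) ⁻¹'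
        {ω' | s ≤ ∑ y ∈ box d (2 * n), (openConn (0 : Site d) y ∩
          {ω'' : BondConfig (Site d) | openCluster ω'' 0 ⊆ ↑(box d (2 * n))}).indicator
            (1 : BondConfig (Site d) → ℝ) ω'}).indicator (1 : BondConfig (Site d) → ℝ) ω := by
  set A : Site d → Set (BondConfig (Site d)) := fun v =>
    BondConfig.relabel (sym2Equiv (Site.shift (-v))) ⁻¹'
      {ω' | s ≤ ∑ y ∈ box d (2 * n), (openConn (0 : Site d) y ∩
        {ω'' : BondConfig (Site d) | openCluster ω'' 0 ⊆ ↑(box d (2 * n))}).indicator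
          (1 : BondConfig (Site d) → ℝ) ω'} with hA
  obtain ⟨u, hu, hsu⟩ := hQG
  set P := (box d n).filter fun v => ω ∈ openConnIn (↑(box d n) : Set (Site d)) u v with hP
  -- the large piece is interior
  have hint : ∀ w ∈ P, w ∉ innerBoundary (zdGraph d) (box d n) := by
    intro w hw hw'
    refine hBQG ⟨w, hw', ?_⟩
    rw [piece_eq_of_mem (box d n) (Finset.mem_filter.1 hw).2]
    exact hsu
  -- every vertex of the large piece realises its recentred event
  have hmem : ∀ v ∈ P, ω ∈ A v := by
    intro v hv
    obtain ⟨hcard, hC⟩ := centred_piece n hω hu hint hv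
    show s ≤ ∑ y ∈ box d (2 * n), (openConn (0 : Site d) y ∩
      {ω'' : BondConfig (Site d) | openCluster ω'' 0 ⊆ ↑(box d (2 * n))}).indicator
        (1 : BondConfig (Site d) → ℝ) (BondConfig.relabel (sym2Equiv (Site.shift (-v))) ω)
    rw [sum_indicator_eq_card _ _ _ hC]
    exact hsu.trans (by exact_mod_cast hcard)
  show s ≤ ∑ v ∈ box d n, (A v).indicator (1 : BondConfig (Site d) → ℝ) ω
  calc s ≤ (P.card : ℝ) := hsu
    _ = ∑ v ∈ P, (A v).indicator (1 : BondConfig (Site d) → ℝ) ω := by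
        rw [Finset.sum_congr rfl fun v hv =>
          Set.indicator_of_mem (hmem v hv) (1 : BondConfig (Site d) → ℝ)]
        simp
    _ ≤ ∑ v ∈ box d n, (A v).indicator (1 : BondConfig (Site d) → ℝ) ω :=
        Finset.sum_le_sum_of_subset_of_nonneg (Finset.filter_subset _ _) fun _ _ _ =>
          Set.indicator_nonneg (fun _ _ => zero_le_one) _

end BoundaryInteriorSplit

open BoundaryInteriorSplit

/-- **stub_boundaryInteriorSplit (the boundary/interior split in one-bit form; every `p`).**
For `s > 0`:
`P_p(some in-box piece of Λ_n has ≥ s vertices)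
   ≤ P_p(some piece touching ∂ⁱⁿΛ_n has ≥ s vertices) + |Λ_n| · (Σ_{y ∈ Λ_{2n}} P_p(0 ↔ y, C(0) ⊆ Λ_{2n})) / s²`.
Proof: module docstring (an interior piece is a whole cluster confined to `Λ_n ⊆ v + Λ_{2n}`
around each of its `≥ s` vertices `v`; two first-moment bounds and translation invariance).
[folklore] -/
theorem stub_boundaryInteriorSplit :
    ∀ (p : unitInterval) (n : ℕ) (s : ℝ), 0 < s →
      (bondPercolation (zdGraph 3) p).real
          {ω | ∃ u ∈ box 3 n,
            s ≤ (((box 3 n).filter fun v => ω ∈ openConnIn ↑(box 3 n) u v).card : ℝ)}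
        ≤ (bondPercolation (zdGraph 3) p).real
            {ω | ∃ u ∈ innerBoundary (zdGraph 3) (box 3 n),
              s ≤ (((box 3 n).filter fun v => ω ∈ openConnIn ↑(box 3 n) u v).card : ℝ)}
          + ((box 3 n).card : ℝ) *
              (∑ y ∈ box 3 (2 * n), (bondPercolation (zdGraph 3) p).real
                (openConn 0 y ∩ {ω | openCluster ω 0 ⊆ ↑(box 3 (2 * n))})) / s ^ 2 := by
  intro p n s hs
  -- the target events `{0 ↔ y} ∩ {C(0) ⊆ B(2n)}` and the centred event `A₀`
  have hTm : ∀ y : Site 3, MeasurableSet (openConn (0 : Site 3) y ∩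
      {ω : BondConfig (Site 3) | openCluster ω 0 ⊆ ↑(box 3 (2 * n))}) := fun y =>
    (measurableSet_openConn_holds 0 y).inter (measurableSet_cluster_subset 0 _)
  set A0 : Set (BondConfig (Site 3)) := {ω | s ≤ ∑ y ∈ box 3 (2 * n), (openConn (0 : Site 3) y ∩
      {ω' : BondConfig (Site 3) | openCluster ω' 0 ⊆ ↑(box 3 (2 * n))}).indicator
        (1 : BondConfig (Site 3) → ℝ) ω} with hA0
  have hA0m : MeasurableSet A0 :=
    measurableSet_le measurable_const
      (Finset.measurable_sum _ fun y _ => measurable_one.indicator (hTm y))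
  -- (2)+(3): first moment over the vertices of the box, then translation invariance
  have h2 := mul_measureReal_le_sum (bondPercolation (zdGraph 3) p) (box 3 n)
    (fun v => BondConfig.relabel (sym2Equiv (Site.shift (-v))) ⁻¹' A0)
    (fun v _ => hA0m.preimage (BondConfig.relabel _).measurable)
    ({ω | ∃ u ∈ box 3 n,
        s ≤ (((box 3 n).filter fun v => ω ∈ openConnIn ↑(box 3 n) u v).card : ℝ)} \
      {ω | ∃ u ∈ innerBoundary (zdGraph 3) (box 3 n),
        s ≤ (((box 3 n).filter fun v => ω ∈ openConnIn ↑(box 3 n) u v).card : ℝ)})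
    hs.le (by
      filter_upwards [ae_subset_edgeSet (zdGraph 3) p] with ω hω
      rintro ⟨hq, hbq⟩
      exact le_sum_indicator n s hω hq hbq)
  have h3 : ∑ v ∈ box 3 n, (bondPercolation (zdGraph 3) p).real
      (BondConfig.relabel (sym2Equiv (Site.shift (-v))) ⁻¹' A0) =
      ((box 3 n).card : ℝ) * (bondPercolation (zdGraph 3) p).real A0 := by
    rw [Finset.sum_congr rfl fun v _ => bondPercolation_real_preimage_shift (-v) p A0,
      Finset.sum_const, nsmul_eq_mul]
  -- (4): first moment over `y ∈ B(2n)` on the centred event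
  have h4 := mul_measureReal_le_sum (bondPercolation (zdGraph 3) p) (box 3 (2 * n))
    (fun y => openConn (0 : Site 3) y ∩
      {ω : BondConfig (Site 3) | openCluster ω 0 ⊆ ↑(box 3 (2 * n))})
    (fun y _ => hTm y) A0 hs.le (ae_of_all _ fun ω hω => hω)
  -- (1)+(5): subadditivity and bookkeeping
  exact split_of_parts _ _ _ A0 hs (Nat.cast_nonneg _) (h2.trans_eq h3) h4

end Summit.CriticalPhenomena.PercolationContinuityZ3.FreeBoxPowerSavingLine

end
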